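import Summits.Ventures.QEC.Census.CertCheck
import Literature.InformationTheory.QuantumCodes.CSSParameters
import HarnessLib

/-!
# Rank certificates (CERT-FORMAT v1 §3 `k_cert`, lemma L0): `k` of a certified CSS code in the kernel

The distance checker `Census/CertCheck.lean` (type-10) certifies `d_X`, `d_Z` of the CSS code `c.code` of a
`DistCert`; the number of logical qubits is `k = n − rank H^X − rank H^Z` (type-02's `CSSCode.k_eq`, Bravyi et
al. 2024 Lemma 1), and `Matrix.rank` is not computable. This file adds the missing piece of the pipeline, the RANK
CERTIFICATE of plan/CERT-FORMAT.md v1 §3 (`k_cert` = two blocks `RC(H)`), literally: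

* `RC(H) = {r, pivot_rows, right_inverse_cols, dependent}` ↦ `RankCert` with fields `r`, `pivots` (row indices
  of `H`), `rinv` (the `r` supports `M_0 … M_{r−1}` over the qubits, bitmasks), `dependent` (pairs
  `(h, positions)`: row `h` of `H` is the XOR of the pivot rows at those positions; CERT-FORMAT lists the non-pivot
  rows, pivot rows may be omitted or listed);
* `RankCert.check n H c : Bool` — `|pivots| = |rinv| = r`, pivots in range, the parity table
  `|H[pivot_rows[a]] ∩ M_i| ≡ [a = i] (mod 2)`, and every row of `H` is a pivot or XORs from its `dependent` entry
  (pure `List`/`Nat` recursion: `decide` / `native_decide`);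
* **L0 soundness** `rank_rowMatrix_of_check : c.check n H = true → (rowMatrix n H).rank = c.r` — from the matrix
  lemma `rank_eq_of_pivots` (rows `piv a` with a right inverse `⟨H (piv a), M i⟩ = [a = i]` are independent, so
  `rank ≥ r`; all rows in their span, so `rank ≤ r`), proved over any field;
* assembly with the distance checker: `DistCert.k_code` (`(c.code _).k = n − rX − rZ`), and
  **`DistCert.isCode_code`** / `isCode_code_of_chunks`: a checked `DistCert` plus two checked `RankCert`s with
  `rX + rZ < n` give the census predicate `(c.code _).IsCode n (n − rX − rZ) (min dX dZ)` (type-02's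
  `CSSCode.IsCode`, PARTITION v2 D2.2) — i.e. the CLAIM `[[n, k, d]]` is discharged in the kernel;
* control (CERT-REQS A1): the `[[4,2,2]]` rank certificates and `IsCode 4 2 2` by `decide` (tier KERNEL).

HONEST FRAMING: nothing here trusts the certificate's producer — the checker recomputes every parity and every XOR;
a `native_decide` discharge would be tier COMPILED and must be flagged by the file that uses it (none here).
-/

namespace Summit.Ventures.QEC.Census

open Matrix Literature.InformationTheory.QuantumCodes

/-! ## Matrix level: rank from pivot rows with a right inverse -/

/-- **Rank from a pivot certificate.** If the rows `H (piv a)`, `a < r`, admit "right-inverse columns" `M i` with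
`⟨H (piv a), M i⟩ = [a = i]`, and every row of `H` lies in their span, then `rank H = r`. (The parity table makes
the pivot rows independent — a relation `Σ cₐ H(piv a) = 0` paired with `M i` gives `cᵢ = 0` — so `rank ≥ r`; the
span condition gives `rank ≤ r`.) CERT-FORMAT v1 §6 lemma L0, over any field. -/
theorem rank_eq_of_pivots {R Q F : Type*} [Fintype R] [Fintype Q] [Field F] {r : ℕ} (H : Matrix R Q F)
    (piv : Fin r → R) (M : Fin r → Q → F) (hM : ∀ a i, H (piv a) ⬝ᵥ M i = if a = i then 1 else 0)
    (hspan : ∀ h : R, H h ∈ Submodule.span F (Set.range fun a => H (piv a))) : H.rank = r := by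
  classical
  apply le_antisymm
  · rw [Matrix.rank_eq_finrank_span_row]
    calc Module.finrank F (Submodule.span F (Set.range H.row))
        ≤ Module.finrank F (Submodule.span F (Set.range fun a => H (piv a))) :=
          Submodule.finrank_mono (Submodule.span_le.2 (by rintro _ ⟨h, rfl⟩; exact hspan h))
      _ ≤ r := by
          have h := finrank_range_le_card (R := F) fun a : Fin r => H (piv a)
          rwa [Fintype.card_fin] at h
  · let Hsel : Matrix (Fin r) Q F := H.submatrix piv id
    let N : Matrix Q (Fin r) F := Matrix.of fun q i => M i q
    have h1 : Hsel * N = 1 := by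
      ext a i
      rw [Matrix.mul_apply, Matrix.one_apply, ← hM a i, dotProduct]
      rfl
    have h2 : r ≤ Hsel.rank := by
      have h := Matrix.rank_mul_le_left Hsel N
      rwa [h1, Matrix.rank_one, Fintype.card_fin] at h
    have h3 : Hsel.rank ≤ H.rank := by
      rw [Matrix.rank_eq_finrank_span_row, Matrix.rank_eq_finrank_span_row]
      exact Submodule.finrank_mono (Submodule.span_mono (by rintro _ ⟨a, rfl⟩; exact ⟨piv a, rfl⟩))
    exact h2.trans h3

/-! ## Word level: the `RC(H)` block of CERT-FORMAT §3 and its checker -/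

/-- A rank certificate `RC(H)` for a row-list matrix `H` (CERT-FORMAT v1 §3 `k_cert.X` / `k_cert.Z`): the claimed
rank `r`, the `r` pivot row indices, the `r` right-inverse column supports `M_i` (bitmasks over the qubits), and the
decompositions of (at least) the non-pivot rows over the pivot rows, as pairs (row index, positions in `pivots`). -/
structure RankCert where
  /-- claimed rank -/
  r : ℕ
  /-- `pivot_rows`: indices of `r` rows of `H` -/
  pivots : List ℕ
  /-- `right_inverse_cols`: `r` supports `M_0 … M_{r−1}` with `|H[pivots[a]] ∩ M_i|` odd iff `a = i` -/
  rinv : List ℕ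
  /-- `dependent`: `(h, sel)` = row `h` of `H` is the XOR of the rows `H[pivots[p]]`, `p ∈ sel` -/
  dependent : List (ℕ × List ℕ)

namespace RankCert

/-- The pivot block checks: lengths, indices in range, and the parity table `|H[pivots[a]] ∩ M_i| ≡ [a = i]`. -/
def pivotsOK (n : ℕ) (H : List ℕ) (c : RankCert) : Bool :=
  (c.pivots.length == c.r) && (c.rinv.length == c.r) && c.pivots.all (fun p => decide (p < H.length)) &&
    (List.range c.r).all fun a => (List.range c.r).all fun i =>
      popc n (H.getD (c.pivots.getD a 0) 0 &&& c.rinv.getD i 0) % 2 == (if a = i then 1 else 0)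

/-- Row `h` of `H` is accounted for: it is a pivot row, or its `dependent` entry XORs to it from the pivot rows. -/
def rowOK (H : List ℕ) (c : RankCert) (h : ℕ) : Bool :=
  c.pivots.elem h ||
    match c.dependent.lookup h with
    | some sel => xorRows (c.pivots.map fun p => H.getD p 0) sel == H.getD h 0
    | none => false

/-- **The rank-certificate checker** for the rows `H` over `n` qubits (CERT-FORMAT §4 O3). -/
def check (n : ℕ) (H : List ℕ) (c : RankCert) : Bool :=
  c.pivotsOK n H && (List.range H.length).all (c.rowOK H)

end RankCert

/-! ## Soundness of the rank checker (L0) -/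

section RankSound

variable {n : ℕ} {H : List ℕ} {c : RankCert}

/-- A natural number cast to `𝔽₂` is decided by its parity. -/
private theorem natCast_zmod2_eq_ite (m : ℕ) : (m : ZMod 2) = if m % 2 = 1 then 1 else 0 := by
  rcases Nat.mod_two_eq_zero_or_one m with h | h
  · rw [if_neg (by omega), ← ZMod.natCast_mod m 2, h, Nat.cast_zero]
  · rw [if_pos h, ← ZMod.natCast_mod m 2, h, Nat.cast_one]

/-- `l.getD i 0 = l[i]` for an index in range. -/
private theorem getD_eq_getElem {l : List ℕ} {i : ℕ} (h : i < l.length) : l.getD i 0 = l[i] := by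
  rw [List.getD_eq_getElem?_getD, List.getElem?_eq_getElem h, Option.getD_some]

/-- **L0**: a passing rank certificate proves `rank (rowMatrix n H) = r`. -/
theorem rank_rowMatrix_of_check (h : c.check n H = true) : (rowMatrix n H).rank = c.r := by
  classical
  simp only [RankCert.check, RankCert.pivotsOK, Bool.and_eq_true, beq_iff_eq, List.all_eq_true,
    List.mem_range, decide_eq_true_eq] at h
  obtain ⟨⟨⟨⟨hlen, -⟩, hlt⟩, hpar⟩, hrow⟩ := h
  -- the pivot rows, as row indices of `rowMatrix n H`
  have hpl : ∀ a : Fin c.r, (a : ℕ) < c.pivots.length := fun a => by rw [hlen]; exact a.2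
  have hpi : ∀ a : Fin c.r, c.pivots.getD a 0 < H.length := fun a => by
    rw [getD_eq_getElem (hpl a)]
    exact hlt _ (List.getElem_mem (hpl a))
  let piv : Fin c.r → Fin H.length := fun a => ⟨c.pivots.getD a 0, hpi a⟩
  have hrowpiv : ∀ a : Fin c.r, rowMatrix n H (piv a) = ofBits n (H.getD (c.pivots.getD a 0) 0) := fun a => by
    funext j
    change ofBits n (H[c.pivots.getD a 0]'(hpi a)) j = _
    rw [getD_eq_getElem (hpi a)]
  refine rank_eq_of_pivots (rowMatrix n H) piv (fun i => ofBits n (c.rinv.getD i 0)) (fun a i => ?_) (fun h => ?_)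
  · -- parity table
    rw [hrowpiv, ofBits_dotProduct, natCast_zmod2_eq_ite, hpar a a.2 i i.2]
    by_cases hai : a = i
    · simp [hai]
    · simp [hai, Fin.val_eq_val]
  · -- every row is a pivot or XORs from pivots
    have hh := hrow h h.2
    simp only [RankCert.rowOK, Bool.or_eq_true] at hh
    rcases hh with hmem | hdep
    · -- a pivot row
      obtain ⟨a, ha, hpa⟩ := List.getElem_of_mem (List.mem_of_elem_eq_true hmem)
      have ha' : a < c.r := hlen ▸ ha
      have hpv : piv ⟨a, ha'⟩ = h := Fin.ext (by
        change c.pivots.getD a 0 = (h : ℕ)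
        rw [getD_eq_getElem ha, hpa])
      exact Submodule.subset_span ⟨⟨a, ha'⟩, by simp only [hpv]⟩
    · -- a dependent row: XOR of pivot rows
      split at hdep
      · rename_i sel _
        rw [beq_iff_eq] at hdep
        have hrowh : rowMatrix n H h = ofBits n (xorRows (c.pivots.map fun p => H.getD p 0) sel) := by
          rw [hdep]
          funext j
          change ofBits n (H[(h : ℕ)]'h.2) j = _
          rw [getD_eq_getElem h.2]
        rw [hrowh]
        have hmem := ofBits_xorRows_mem_rowSpace n (c.pivots.map fun p => H.getD p 0) sel
        have hle : rowSpace (rowMatrix n (c.pivots.map fun p => H.getD p 0)) ≤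
            Submodule.span (ZMod 2) (Set.range fun a => rowMatrix n H (piv a)) := by
          unfold rowSpace
          rw [range_vecMulLinear, Submodule.span_le]
          rintro _ ⟨j, rfl⟩
          have hjl : (j : ℕ) < c.pivots.length := by
            have := j.2; simp only [List.length_map] at this; exact this
          have hj : (j : ℕ) < c.r := hlen ▸ hjl
          refine Submodule.subset_span ⟨⟨j, hj⟩, ?_⟩
          change rowMatrix n H (piv ⟨j, hj⟩) = fun q => ofBits n ((c.pivots.map fun p => H.getD p 0)[(j : ℕ)]'j.2) q
          rw [hrowpiv]
          funext q
          rw [List.getElem_map, getD_eq_getElem hjl]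
        exact hle hmem
      · exact absurd hdep Bool.false_ne_true

end RankSound

/-! ## Assembly: `k` and the census predicate `[[n, k, d]]` for a certified code -/

namespace DistCert

variable (c : DistCert)

/-- **`k` of a certified code**: with rank certificates for `H^X` and `H^Z`, `k = n − rX − rZ` (type-02's
`CSSCode.k_eq`: `k = n − rank H^X − rank H^Z`, Bravyi et al. 2024 Lemma 1). -/
theorem k_code (hc : commOK c.n c.HX c.HZ = true) {cX cZ : RankCert} (hX : cX.check c.n c.HX = true)
    (hZ : cZ.check c.n c.HZ = true) : (c.code hc).k = c.n - cX.r - cZ.r := by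
  rw [CSSCode.k_eq, Fintype.card_fin, show (c.code hc).HX = rowMatrix c.n c.HX from rfl,
    show (c.code hc).HZ = rowMatrix c.n c.HZ from rfl, rank_rowMatrix_of_check hX, rank_rowMatrix_of_check hZ]

/-- **The CLAIM discharged, monolithic form**: a checked distance certificate and two checked rank certificates with
`rX + rZ < n` give `[[n, n − rX − rZ, min(dX, dZ)]]` for the certificate's code (census predicate
`CSSCode.IsCode`: exact distance through `cssMinDist`). -/
theorem isCode_code (h : c.checkDistCert = true) {cX cZ : RankCert} (hX : cX.check c.n c.HX = true)
    (hZ : cZ.check c.n c.HZ = true) (hk : cX.r + cZ.r < c.n) :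
    (c.code (c.commOK_of_check h)).IsCode c.n (c.n - cX.r - cZ.r) (min c.dX c.dZ) := by
  have hkc := c.k_code (c.commOK_of_check h) hX hZ
  have hpos : 0 < (c.code (c.commOK_of_check h)).k := by rw [hkc]; omega
  have := (c.code (c.commOK_of_check h)).isCode_of_dX_dZ hpos (c.dX_code h) (c.dZ_code h)
  rwa [Fintype.card_fin, hkc] at this

/-- **The CLAIM discharged, chunked form**: structural check, all `Z`- and `X`-chunks, and the two rank
certificates give `[[n, n − rX − rZ, min(dX, dZ)]]`. -/
theorem isCode_code_of_chunks (hs : c.checkStructure = true) (hZc : ∀ i : ℕ, i < c.n → c.chunkZ i = true)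
    (hXc : ∀ i : ℕ, i < c.n → c.chunkX i = true) {cX cZ : RankCert} (hX : cX.check c.n c.HX = true)
    (hZ : cZ.check c.n c.HZ = true) (hk : cX.r + cZ.r < c.n) :
    (c.code (c.commOK_of_checkStructure hs)).IsCode c.n (c.n - cX.r - cZ.r) (min c.dX c.dZ) := by
  have hkc := c.k_code (c.commOK_of_checkStructure hs) hX hZ
  have hpos : 0 < (c.code (c.commOK_of_checkStructure hs)).k := by rw [hkc]; omega
  have := (c.code (c.commOK_of_checkStructure hs)).isCode_of_dX_dZ hpos (c.dX_code_of_chunks hs hXc)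
    (c.dZ_code_of_chunks hs hZc)
  rwa [Fintype.card_fin, hkc] at this

end DistCert

/-! ## Control (CERT-REQS A1): `[[4,2,2]]` is a `[[4,2,2]]` code, tier KERNEL -/

/-- The rank certificate of `H = [1111]` (both sides of the `[[4,2,2]]` code, CERT-FORMAT §8 example):
`r = 1`, pivot row `0`, right-inverse column `{qubit 0}`, no dependent rows. -/
def rankCertC422 : RankCert where
  r := 1
  pivots := [0]
  rinv := [1]
  dependent := []

/-- The rank checker accepts it (by `decide`). -/
theorem check_rankCertC422 : rankCertC422.check 4 [15] = true := by decide

/-- **`[[4,2,2]]` CERTIFIED**: the code of `certC422` is a `[[4, 2, 2]]` code (kernel tier: `decide` only,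
axioms ⊆ {propext, Classical.choice, Quot.sound}). -/
theorem isCode_certC422 :
    (certC422.code (certC422.commOK_of_check checkDistCert_certC422)).IsCode 4 2 2 :=
  certC422.isCode_code checkDistCert_certC422 check_rankCertC422 check_rankCertC422 (by decide)

end Summit.Ventures.QEC.Census
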